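import Literature.AlgebraicGeometry.Deformation.LocalHilbertFunctorTangentSheafCoordinates
import Literature.AlgebraicGeometry.Deformation.CompatibleObstructionTheories
import HarnessLib

/-!
# The local Hilbert functor has a complete obstruction theory with values in `H¹(Z, 𝒩_{Z/X})`

[Hartshorne2010, Thm. 6.2 (b)]: for a closed subscheme `Y ⊆ X` (flat over `A`) whose extensions over a small extension
`0 → J → A′ → A → 0` exist locally, there is an obstruction `α ∈ H¹(Y₀, 𝒩₀ ⊗_k J)` «whose vanishing is necessary and
sufficient for the global existence of `Y′`»; [Hartshorne2010, §11 Definition (b) / Ex. 15.5] and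
[Manetti1999DeformationTheoryDGLA, Def. 2.12–2.13] ∕ [FantechiManetti1999T1Lifting, Def. 0.1] ask for such classes for ALL small
extensions, compatibly with morphisms of small extensions («base change `(Id_V ⊗ α_M)`»). The tree has the class
`ob(y, π) ∈ H¹(Z, T_π)` for every surjection datum `π` (`localHilbertFunctor.liftObstruction`, any `dim_k J`), its functoriality
`H¹(T_α)(ob(y, π₁)) = ob(ᾱ_* y, π₂)` (`LocalHilbertFunctorLiftObstructionNaturality`) and the coordinates `T_π ≅ 𝒩_{Z/X} ⊗_k J`
(`LocalHilbertFunctorTangentSheafCoordinates`). HERE they are assembled: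

* §1 `hilbTangentH1Coord : H¹(Z, T_π) →+ H¹(Z, 𝒩_{Z/X}) ⊗_k J`, `x ↦ Σ_l H¹(ρ_{b_l^*})(x) ⊗ b_l` (a basis `(b_l)` of `J`), with the
  PROBE FORMULA `(𝟙 ⊗ w)(Φ x) = H¹(ρ_w)(x) ⊗ 1` for every functional `w` (`hilbTangentH1Coord_lTensor`; from `ρ_w = Σ ρ_{b_l^*} ≫ (w(b_l)·)`)
  — so `Φ` does not depend on the basis — and INJECTIVE (`hilbTangentH1Coord_injective`; from `Σ ρ_{b_l^*} ≫ ψ_ε⁻¹ ≫ μ_{b_l} = 𝟙`);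
* §2 **`localHilbertFunctor.normalObstructionTheory`**: under the hypothesis of Thm. 6.2 (b) that lifts exist locally on `Z` along
  every small extension (`hloc`), the classes `Φ(ob(y, π)) ∈ H¹(Z, 𝒩_{Z/X}) ⊗_k J` form an
  `ArtinFunctor.ObstructionTheory (localHilbertFunctor X ι₀.ker) (H¹(Z, 𝒩_{Z/X}))` in the sense of
  `CompatibleObstructionTheories.lean` ([Manetti1999DeformationTheoryDGLA, Def. 2.12]): (1) the class vanishes when `y` lifts;
  (2) base change along every morphism of small extensions (probe by probe: a probe `w₂` of `J₂` pulls back to the probe `w₂ ∘ α`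
  of `J₁`, or to `0`, and `LocalHilbertFunctorNormalObstructionBaseChange` ∕ `T_α = 0` apply);
* §3 it is COMPLETE ([Manetti1999DeformationTheoryDGLA, Def. 2.13]; `Z ≠ ∅`): `Φ(ob(y, π)) = 0 ↔ y` lifts
  (`localHilbertFunctor.normalObstructionTheory_isComplete`, `…_ob_eq_zero_iff`) — Thm. 6.2 (b) as printed, for `J` of any dimension.

HONEST SCOPE. (1) As the parents: embedded deformations of `Z` inside the trivial deformations `X × Spec A` only (the local
Hilbert functor `H_Z^X` of `X/k`), `X` locally Noetherian; print allows any flat `X′/A′`. (2) The local-existence hypothesis of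
Thm. 6.2 (b) is carried as the explicit argument `hloc` (every `y`, every small extension); the tree has no «locally unobstructed ∕
l.c.i.» predicate discharging it. (3) `H¹(Z, 𝒩_{Z/X})` carries the `k`-structure `normalCohomologyModuleK` (bind with `letI`, as in
the parents); the kernel is FM's `kerₖ k p`, identified with Schlessinger's `ArtAlg.kerSubmodule p` by `ArtAlg.kerSubmoduleEquivKer`
(same carrier). (4) Not here: the comparison with a hull ∕ [Hartshorne2010, Thm. 11.1, Cor. 11.2, Thm. 11.3] (`dim ≥ h⁰(𝒩) − h¹(𝒩)`),
which needs the presented-hull bridge of `ObstructionSpaceDimensionBound.lean`. Nothing here asserts a Hodge-type statement.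

## References
* [Hartshorne2010] R. Hartshorne, *Deformation Theory*, GTM 257 (2010): Thm. 6.2 (b) pp. 46–49; §11 Definition p. 96; Ex. 15.5.
* [Manetti1999DeformationTheoryDGLA] M. Manetti, Deformation theory via differential graded Lie algebras (1999): Def. 2.12, 2.13.
* [FantechiManetti1999T1Lifting] B. Fantechi, M. Manetti, On the `T¹`-lifting theorem, J. Algebraic Geom. 8 (1999): Def. 0.1.
* [Schlessinger1968] M. Schlessinger, Functors of Artin rings, Trans. AMS 130 (1968): Lemma 2.10, (2.17).
-/

noncomputable section

-- `(X ⊗ T).left = pullback X.hom T.hom` is `rfl` (`Over.tensorObj_left`) only at default transparency; as in the parents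
set_option backward.isDefEq.respectTransparency false -- `HilbTangentSheafNormalSheafIso.lean` ∕ Mathlib's `Cartesian.Over`

open CategoryTheory Limits MonoidalCategory Opposite TopologicalSpace IsLocalRing _root_.AlgebraicGeometry
  _root_.AlgebraicGeometry.Scheme.IdealSheafData Literature.AlgebraicGeometry.Motives Literature.AlgebraicGeometry.Modules
open scoped TensorProduct

universe u

namespace Literature.AlgebraicGeometry.Deformation

/-! ## §0 Linear-algebra helpers: probes of `V ⊗ M`, sums under `H¹` -/

section Helpers

variable {k : Type u} [Field k]

/-- The `l`-th coordinate of `z ∈ V ⊗ M` in the basis `b` is `(𝟙 ⊗ b_l^*)(z) ∈ V ⊗ k = V`. [folklore] -/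
private theorem finsuppScalarRight_lTensor_repr_apply {V M : Type*} [AddCommGroup V] [Module k V] [AddCommGroup M]
    [Module k M] {ι : Type*} [DecidableEq ι] (b : Module.Basis ι k M) (z : V ⊗[k] M) (l : ι) :
    TensorProduct.finsuppScalarRight k k V ι ((b.repr : M →ₗ[k] ι →₀ k).lTensor V z) l =
      TensorProduct.rid k V ((b.coord l).lTensor V z) := by
  rw [TensorProduct.finsuppScalarRight_apply, ← LinearMap.comp_apply, ← LinearMap.lTensor_comp]
  rfl

/-- Probe extensionality: `z, z′ ∈ V ⊗_k M` agree as soon as `(𝟙 ⊗ b_l^*)(z) = (𝟙 ⊗ b_l^*)(z′)` for the coordinate functionals of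
a basis. [folklore] -/
private theorem tmul_ext_of_lTensor_coord {V M : Type*} [AddCommGroup V] [Module k V] [AddCommGroup M] [Module k M]
    {ι : Type*} [DecidableEq ι] (b : Module.Basis ι k M) (z z' : V ⊗[k] M)
    (h : ∀ l, (b.coord l).lTensor V z = (b.coord l).lTensor V z') : z = z' := by
  have hinj : Function.Injective ((b.repr : M →ₗ[k] ι →₀ k).lTensor V) := (LinearEquiv.lTensor V b.repr).injective
  apply hinj
  apply (TensorProduct.finsuppScalarRight k k V ι).injective
  ext l
  rw [finsuppScalarRight_lTensor_repr_apply, finsuppScalarRight_lTensor_repr_apply, h l]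

/-- `(𝟙 ⊗ b_{l′}^*)(Σ_l y_l ⊗ b_l) = y_{l′} ⊗ 1`. [folklore] -/
private theorem lTensor_coord_sum_tmul {V M : Type*} [AddCommGroup V] [Module k V] [AddCommGroup M] [Module k M]
    {ι : Type*} [Fintype ι] [DecidableEq ι] (b : Module.Basis ι k M) (y : ι → V) (l' : ι) :
    (b.coord l').lTensor V (∑ l, y l ⊗ₜ[k] b l) = y l' ⊗ₜ[k] 1 := by
  rw [map_sum]
  simp_rw [LinearMap.lTensor_tmul, Module.Basis.coord_apply, Module.Basis.repr_self, Finsupp.single_apply]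
  rw [Finset.sum_eq_single l' (fun l _ hl => by rw [if_neg hl, TensorProduct.tmul_zero]) (fun h => absurd (Finset.mem_univ _) h),
    if_pos rfl]

/-- `(𝟙 ⊗ w)(Σ_l y_l ⊗ b_l) = (Σ_l w(b_l) • y_l) ⊗ 1`. [folklore] -/
private theorem lTensor_sum_tmul {V M : Type*} [AddCommGroup V] [Module k V] [AddCommGroup M] [Module k M]
    {ι : Type*} [Fintype ι] (b : ι → M) (y : ι → V) (w : M →ₗ[k] k) :
    w.lTensor V (∑ l, y l ⊗ₜ[k] b l) = (∑ l, w (b l) • y l) ⊗ₜ[k] (1 : k) := by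
  rw [map_sum, TensorProduct.sum_tmul]
  refine Finset.sum_congr rfl fun l _ => ?_
  rw [LinearMap.lTensor_tmul, ← TensorProduct.smul_tmul', ← TensorProduct.tmul_smul, smul_eq_mul, mul_one]

/-- A nonzero functional takes the value `1`. [folklore] -/
private theorem exists_apply_eq_one {M : Type*} [AddCommGroup M] [Module k M] (w : M →ₗ[k] k) (hw : w ≠ 0) :
    ∃ t : M, w t = 1 := by
  obtain ⟨t₀, ht₀⟩ : ∃ t₀, w t₀ ≠ 0 := by
    by_contra h
    exact hw (LinearMap.ext fun t => not_not.1 fun ht => h ⟨t, ht⟩)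
  exact ⟨(w t₀)⁻¹ • t₀, by rw [map_smul, smul_eq_mul, inv_mul_cancel₀ ht₀]⟩

/-- `Hⁿ` is additive in the morphism over finite sums. [folklore] -/
private theorem sheafH_map_sum_apply {C : Type u} [Category.{u} C] {J : GrothendieckTopology C}
    {F G : Sheaf J AddCommGrpCat.{u}} {ι : Type*} (s : Finset ι) (f : ι → (F ⟶ G)) (n : ℕ) (x : F.H n) :
    Sheaf.H.map (∑ l ∈ s, f l) n x = ∑ l ∈ s, Sheaf.H.map (f l) n x := by
  classical
  induction s using Finset.induction_on with
  | empty =>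
    rw [Finset.sum_empty, Finset.sum_empty]
    have h := Sheaf.H.map_add_apply (0 : F ⟶ G) 0 x
    rw [add_zero] at h
    exact (left_eq_add.mp h).symm ▸ rfl
  | insert a s ha ih => rw [Finset.sum_insert ha, Finset.sum_insert ha, Sheaf.H.map_add_apply, ih]

end Helpers

/-! ## §1 The coordinate map `Φ : H¹(Z, T_π) → H¹(Z, 𝒩_{Z/X}) ⊗_k J` -/

section Coord

variable {k : Type u} [Field k] (X : Motives.SchemeOver k) {Z : Scheme.{u}} (ι₀ : Z ⟶ X.left) [IsClosedImmersion ι₀]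
  [IsLocallyNoetherian X.left]
  {A' A : ArtAlg.{u} k} (π : A' →ₐ[k] A) (hI : RingHom.ker π * maximalIdeal A' = ⊥) (aug : ↥A' →ₐ[k] k)
  (hπ : Function.Surjective π)

/-- A basis of `J = ker π` (finite-dimensional: `A′` is). Definition with body. [cite: Schlessinger1968, Lemma 2.10 (proof), p. 212] -/
def ArtAlg.kerBasis : Module.Basis (Fin (haveI : Module.Finite k ↥A' := A'.moduleFinite; Module.finrank k ↥(ArtAlg.kerSubmodule π))) k
    ↥(ArtAlg.kerSubmodule π) :=
  haveI : Module.Finite k ↥A' := A'.moduleFinite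
  Module.finBasis k ↥(ArtAlg.kerSubmodule π)

/-- `b_l^*(b_l) = 1` for the chosen basis. [cite: Schlessinger1968, Lemma 2.10 (proof), p. 212] -/
theorem ArtAlg.kerBasis_coord_self (l) : (ArtAlg.kerBasis π).coord l (ArtAlg.kerBasis π l) = 1 := by
  rw [Module.Basis.coord_apply, Module.Basis.repr_self, Finsupp.single_eq_same]

/-- **`Φ : H¹(Z, T_π) →+ H¹(Z, 𝒩_{Z/X}) ⊗_k J`, `x ↦ Σ_l H¹(ρ_{b_l^*})(x) ⊗ b_l`** — `H¹` of the coordinates of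
`T_π ≅ 𝒩_{Z/X} ⊗_k J` (`LocalHilbertFunctorTangentSheafCoordinates`), i.e. `H¹(Z, 𝒩₀ ⊗_k J) = H¹(Z, 𝒩₀) ⊗_k J`. Written with the
chosen basis `kerBasis`; basis-free by the probe formula below. Definition with body.
[cite: Hartshorne2010, Thm. 6.2 (b), p. 47 («`H¹(Y₀, 𝒩₀ ⊗_k J)`»)] [cite: Manetti1999DeformationTheoryDGLA, Def. 2.12 («`V ⊗ M`»)] -/
def hilbTangentH1Coord :
    letI := normalCohomologyModuleK X ι₀ 1
    (hilbTangentSheaf X ι₀ π hI aug).H 1 →+ HodgeTheory.normalSheafCohomology ι₀ 1 ⊗[k] ↥(ArtAlg.kerSubmodule π) :=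
  letI := normalCohomologyModuleK X ι₀ 1
  { toFun := fun x => ∑ l, Sheaf.H.map (hilbTangentProbe X ι₀ π hI aug hπ ((ArtAlg.kerBasis π).coord l) (ArtAlg.kerBasis π l)
        (ArtAlg.kerBasis_coord_self π l)) 1 x ⊗ₜ[k] ArtAlg.kerBasis π l
    map_zero' := by simp_rw [map_zero, TensorProduct.zero_tmul, Finset.sum_const_zero]
    map_add' := fun x y => by simp_rw [map_add, TensorProduct.add_tmul, Finset.sum_add_distrib] }

/-- Unfolding `Φ`. [cite: Hartshorne2010, Thm. 6.2 (b), p. 47] -/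
theorem hilbTangentH1Coord_apply (x : (hilbTangentSheaf X ι₀ π hI aug).H 1) :
    letI := normalCohomologyModuleK X ι₀ 1
    hilbTangentH1Coord X ι₀ π hI aug hπ x =
      ∑ l, Sheaf.H.map (hilbTangentProbe X ι₀ π hI aug hπ ((ArtAlg.kerBasis π).coord l) (ArtAlg.kerBasis π l)
        (ArtAlg.kerBasis_coord_self π l)) 1 x ⊗ₜ[k] ArtAlg.kerBasis π l :=
  rfl

omit [IsClosedImmersion ι₀] [IsLocallyNoetherian X.left] in
/-- The `k`-action on `H¹(Z, 𝒩_{Z/X})` is `H¹` of the homothety (by `rfl`, `normalCohomology_smul_def`).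
[cite: Hartshorne1977, III Remark 2.6.1, p. 208] -/
theorem normalCohomology_smul_eq_map (c : k) (ξ : HodgeTheory.normalSheafCohomology ι₀ 1) :
    letI := normalCohomologyModuleK X ι₀ 1
    c • ξ = Sheaf.H.map (normalSheafAbScalar ι₀ (subschemeScalar X ι₀ c)) 1 ξ :=
  rfl

/-- **Probe formula: `(𝟙 ⊗ w)(Φ x) = H¹(ρ_w)(x) ⊗ 1`** for every functional `w` of `J` with `w t = 1` — by
`ρ_w = Σ_l ρ_{b_l^*} ≫ (w(b_l) ·)` (`hilbTangentProbe_eq_sum`) and additivity of `H¹` in the morphism. In particular `Φ` does not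
depend on the basis used to write it. [cite: Manetti1999DeformationTheoryDGLA, Def. 2.12] [cite: Hartshorne2010, §11 Definition (b), p. 96] -/
theorem hilbTangentH1Coord_lTensor (w : ↥(ArtAlg.kerSubmodule π) →ₗ[k] k) (t : ↥(ArtAlg.kerSubmodule π)) (ht : w t = 1)
    (x : (hilbTangentSheaf X ι₀ π hI aug).H 1) :
    letI := normalCohomologyModuleK X ι₀ 1
    w.lTensor (HodgeTheory.normalSheafCohomology ι₀ 1) (hilbTangentH1Coord X ι₀ π hI aug hπ x) =
      Sheaf.H.map (hilbTangentProbe X ι₀ π hI aug hπ w t ht) 1 x ⊗ₜ[k] (1 : k) := by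
  letI := normalCohomologyModuleK X ι₀ 1
  rw [hilbTangentH1Coord_apply, lTensor_sum_tmul, hilbTangentProbe_eq_sum X ι₀ π hI aug hπ (ArtAlg.kerBasis π) w t ht,
    sheafH_map_sum_apply]
  congr 1
  refine Finset.sum_congr rfl fun l _ => ?_
  rw [normalCohomology_smul_eq_map, ← Sheaf.H.map_comp_apply]

/-- The coordinates of `Φ x` are the `H¹(ρ_{b_l^*})(x)`. [cite: Hartshorne2010, Thm. 6.2 (b), p. 47] -/
theorem hilbTangentH1Coord_coord (x : (hilbTangentSheaf X ι₀ π hI aug).H 1) (l) :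
    letI := normalCohomologyModuleK X ι₀ 1
    TensorProduct.rid k _ (((ArtAlg.kerBasis π).coord l).lTensor (HodgeTheory.normalSheafCohomology ι₀ 1)
        (hilbTangentH1Coord X ι₀ π hI aug hπ x)) =
      Sheaf.H.map (hilbTangentProbe X ι₀ π hI aug hπ ((ArtAlg.kerBasis π).coord l) (ArtAlg.kerBasis π l)
        (ArtAlg.kerBasis_coord_self π l)) 1 x := by
  letI := normalCohomologyModuleK X ι₀ 1
  rw [hilbTangentH1Coord_lTensor X ι₀ π hI aug hπ _ _ (ArtAlg.kerBasis_coord_self π l), TensorProduct.rid_tmul, one_smul]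

/-- **`Φ` is injective** (`Z` arbitrary): `x = H¹(𝟙)(x) = Σ_l H¹(ψ_ε⁻¹ ≫ μ_{b_l})(H¹(ρ_{b_l^*})(x))`
(`sum_hilbTangentProbe_comp_inv_comp_lineMap`), and the `H¹(ρ_{b_l^*})(x)` are the coordinates of `Φ x`.
[cite: Hartshorne2010, Thm. 6.2 (b), p. 47 («`H¹(Y₀, 𝒩₀ ⊗_k J)`»)] [cite: Schlessinger1968, Lemma 2.10 and (2.17)] -/
theorem hilbTangentH1Coord_injective : Function.Injective (hilbTangentH1Coord X ι₀ π hI aug hπ) := by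
  letI := normalCohomologyModuleK X ι₀ 1
  refine (injective_iff_map_eq_zero _).2 fun x hx => ?_
  have hcoord : ∀ l, Sheaf.H.map (hilbTangentProbe X ι₀ π hI aug hπ ((ArtAlg.kerBasis π).coord l) (ArtAlg.kerBasis π l)
      (ArtAlg.kerBasis_coord_self π l)) 1 x = 0 := fun l => by
    rw [← hilbTangentH1Coord_coord X ι₀ π hI aug hπ x l, hx, map_zero, map_zero]
  rw [← Sheaf.H.map_id_apply x, ← sum_hilbTangentProbe_comp_inv_comp_lineMap X ι₀ π hI aug hπ (ArtAlg.kerBasis π),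
    sheafH_map_sum_apply]
  refine Finset.sum_eq_zero fun l _ => ?_
  rw [Sheaf.H.map_comp_apply, hcoord l, map_zero]

end Coord

/-! ## §2 The obstruction theory `(H¹(Z, 𝒩_{Z/X}), Φ(ob(y, π)))` of `H_Z^X` -/

section Theory

variable {k : Type u} [Field k]

/-- Schlessinger's `ArtAlg.kerSubmodule p` and Fantechi–Manetti's `kerₖ k p` are the same subspace of `R₁` (`p x = 0`).
Definition with body. [cite: FantechiManetti1999T1Lifting, §0 p. 2] [cite: Schlessinger1968, (2.15), p. 213] -/
def ArtAlg.kerSubmoduleEquivKer {R₁ R₀ : ArtAlg.{u} k} (p : R₁ →ₐ[k] R₀) : ↥(ArtAlg.kerSubmodule p) ≃ₗ[k] ↥(kerₖ k p) :=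
  LinearEquiv.ofEq _ _ (Submodule.ext fun x => by rw [ArtAlg.mem_kerSubmodule]; exact Iff.rfl)

/-- On elements the identification is the identity of `R₁`. [cite: FantechiManetti1999T1Lifting, §0 p. 2] -/
theorem ArtAlg.coe_kerSubmoduleEquivKer {R₁ R₀ : ArtAlg.{u} k} (p : R₁ →ₐ[k] R₀) (x : ↥(ArtAlg.kerSubmodule p)) :
    ((ArtAlg.kerSubmoduleEquivKer p x : ↥(kerₖ k p)) : ↥R₁) = x :=
  rfl

/-- … and of its inverse. [cite: FantechiManetti1999T1Lifting, §0 p. 2] -/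
theorem ArtAlg.coe_kerSubmoduleEquivKer_symm {R₁ R₀ : ArtAlg.{u} k} (p : R₁ →ₐ[k] R₀) (x : ↥(kerₖ k p)) :
    (((ArtAlg.kerSubmoduleEquivKer p).symm x : ↥(ArtAlg.kerSubmodule p)) : ↥R₁) = x :=
  rfl

variable (X : Motives.SchemeOver k) {Z : Scheme.{u}} (ι₀ : Z ⟶ X.left) [IsClosedImmersion ι₀] [IsLocallyNoetherian X.left]

/-- **The obstruction of `y ∈ H_Z^X(A)` along a small extension `p : A′ → A` in `H¹(Z, 𝒩_{Z/X}) ⊗_k J`** (`J = ker p` of any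
dimension): `Φ(ob(y, p))` read in Fantechi–Manetti's `kerₖ`. Requires lifts of `y` near every point of `Z` (hypothesis of
Thm. 6.2 (b)). Definition with body. [cite: Hartshorne2010, Thm. 6.2 (b), p. 47] [cite: Manetti1999DeformationTheoryDGLA, Def. 2.12] -/
def localHilbertFunctor.normalObstructionKer {A' A : ArtAlg.{u} k} (p : A' →ₐ[k] A) (hp : IsSmallExt k p)
    (y : (localHilbertFunctor X ι₀.ker).obj A) (hloc : ∀ z : Z, ∃ V : Z.Opens, z ∈ V ∧ Nonempty (liftsOver X ι₀ p y V)) :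
    letI := normalCohomologyModuleK X ι₀ 1
    HodgeTheory.normalSheafCohomology ι₀ 1 ⊗[k] ↥(kerₖ k p) :=
  letI := normalCohomologyModuleK X ι₀ 1
  (ArtAlg.kerSubmoduleEquivKer p : ↥(ArtAlg.kerSubmodule p) →ₗ[k] ↥(kerₖ k p)).lTensor _
    (hilbTangentH1Coord X ι₀ p hp.ker_mul_maximalIdeal A'.residue hp.surjective
      (localHilbertFunctor.liftObstruction X ι₀ p hp.ker_mul_maximalIdeal A'.residue hp.surjective y hloc))

/-- Unfolding `normalObstructionKer`. [cite: Hartshorne2010, Thm. 6.2 (b), p. 47] -/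
theorem localHilbertFunctor.normalObstructionKer_def {A' A : ArtAlg.{u} k} (p : A' →ₐ[k] A) (hp : IsSmallExt k p)
    (y : (localHilbertFunctor X ι₀.ker).obj A) (hloc : ∀ z : Z, ∃ V : Z.Opens, z ∈ V ∧ Nonempty (liftsOver X ι₀ p y V)) :
    letI := normalCohomologyModuleK X ι₀ 1
    localHilbertFunctor.normalObstructionKer X ι₀ p hp y hloc =
      (ArtAlg.kerSubmoduleEquivKer p : ↥(ArtAlg.kerSubmodule p) →ₗ[k] ↥(kerₖ k p)).lTensor _
        (hilbTangentH1Coord X ι₀ p hp.ker_mul_maximalIdeal A'.residue hp.surjective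
          (localHilbertFunctor.liftObstruction X ι₀ p hp.ker_mul_maximalIdeal A'.residue hp.surjective y hloc)) :=
  rfl

/-- **(1) The class vanishes when `y` lifts.** [cite: Hartshorne2010, proof of Thm. 6.2 (b), p. 49]
[cite: Manetti1999DeformationTheoryDGLA, Def. 2.12 (1)] -/
theorem localHilbertFunctor.normalObstructionKer_eq_zero_of_map_eq {A' A : ArtAlg.{u} k} (p : A' →ₐ[k] A) (hp : IsSmallExt k p)
    (y : (localHilbertFunctor X ι₀.ker).obj A) (hloc : ∀ z : Z, ∃ V : Z.Opens, z ∈ V ∧ Nonempty (liftsOver X ι₀ p y V))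
    (y' : (localHilbertFunctor X ι₀.ker).obj A') (hy' : (localHilbertFunctor X ι₀.ker).map p y' = y) :
    localHilbertFunctor.normalObstructionKer X ι₀ p hp y hloc = 0 := by
  letI := normalCohomologyModuleK X ι₀ 1
  rw [localHilbertFunctor.normalObstructionKer_def,
    localHilbertFunctor.liftObstruction_eq_zero_of_map_eq X ι₀ p hp.ker_mul_maximalIdeal A'.residue hp.surjective y hloc y' hy',
    map_zero, map_zero]

/-- **(complete) The class vanishes iff `y` lifts** (`Z ≠ ∅`; `Φ` injective, `liftObstruction_eq_zero_iff`).
[cite: Hartshorne2010, Thm. 6.2 (b) («whose vanishing is necessary and sufficient»), pp. 47–49]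
[cite: Manetti1999DeformationTheoryDGLA, Def. 2.13] -/
theorem localHilbertFunctor.normalObstructionKer_eq_zero_iff [Nonempty Z] {A' A : ArtAlg.{u} k} (p : A' →ₐ[k] A)
    (hp : IsSmallExt k p) (y : (localHilbertFunctor X ι₀.ker).obj A)
    (hloc : ∀ z : Z, ∃ V : Z.Opens, z ∈ V ∧ Nonempty (liftsOver X ι₀ p y V)) :
    localHilbertFunctor.normalObstructionKer X ι₀ p hp y hloc = 0 ↔
      ∃ y' : (localHilbertFunctor X ι₀.ker).obj A', (localHilbertFunctor X ι₀.ker).map p y' = y := by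
  letI := normalCohomologyModuleK X ι₀ 1
  refine ⟨fun h => ?_, fun ⟨y', hy'⟩ => localHilbertFunctor.normalObstructionKer_eq_zero_of_map_eq X ι₀ p hp y hloc y' hy'⟩
  rw [localHilbertFunctor.normalObstructionKer_def] at h
  have h' := (LinearEquiv.lTensor (HodgeTheory.normalSheafCohomology ι₀ 1) (ArtAlg.kerSubmoduleEquivKer p)).injective
    (h.trans (map_zero _).symm)
  exact (localHilbertFunctor.liftObstruction_eq_zero_iff X ι₀ p hp.ker_mul_maximalIdeal A'.residue hp.surjective y hloc).1
    ((injective_iff_map_eq_zero _).1 (hilbTangentH1Coord_injective X ι₀ p hp.ker_mul_maximalIdeal A'.residue hp.surjective) _ h')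

/-- **(2) Base change, probe by probe.** For a morphism `(α, ᾱ) : p₁ → p₂` of small extensions with kernel map `g = α|_J`, a
functional `w₂` of `J₂` with `w₂ t₂ = 1`, and the tangent-sheaf class: `H¹(T_α ≫ ρ_{w₂})(x)` is `H¹(ρ_{w₂ ∘ g})(x)` when
`(w₂ ∘ g) t₁ = 1`, and `0` when `w₂ ∘ g = 0` (the composite `A′₁ → A′₂ → A′₂/ker w₂` descends to the quotients, resp. kills `J₁`).
[cite: Manetti1999DeformationTheoryDGLA, Def. 2.12 (2)] [cite: Hartshorne2010, §11 Definition (b), p. 96] -/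
theorem hilbTangentSheafMap_comp_hilbTangentProbe {A'₁ A₁ A'₂ A₂ : ArtAlg.{u} k}
    (π₁ : A'₁ →ₐ[k] A₁) (h₁ : RingHom.ker π₁ * maximalIdeal A'₁ = ⊥) (aug₁ : ↥A'₁ →ₐ[k] k) (hπ₁ : Function.Surjective π₁)
    (π₂ : A'₂ →ₐ[k] A₂) (h₂ : RingHom.ker π₂ * maximalIdeal A'₂ = ⊥) (aug₂ : ↥A'₂ →ₐ[k] k) (hπ₂ : Function.Surjective π₂)
    (α : ↥A'₁ →ₐ[k] ↥A'₂) (ᾱ : ↥A₁ →ₐ[k] ↥A₂) (hsq : π₂.comp α = ᾱ.comp π₁)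
    (g : ↥(ArtAlg.kerSubmodule π₁) →ₗ[k] ↥(ArtAlg.kerSubmodule π₂)) (hg : ∀ j, ((g j : ↥(ArtAlg.kerSubmodule π₂)) : ↥A'₂) = α j)
    (w₂ : ↥(ArtAlg.kerSubmodule π₂) →ₗ[k] k) (t₂ : ↥(ArtAlg.kerSubmodule π₂)) (ht₂ : w₂ t₂ = 1)
    (t₁ : ↥(ArtAlg.kerSubmodule π₁)) (ht₁ : (w₂ ∘ₗ g) t₁ = 1) :
    hilbTangentSheafMap X ι₀ π₁ h₁ aug₁ π₂ h₂ aug₂ α ᾱ hsq hπ₂ ≫ hilbTangentProbe X ι₀ π₂ h₂ aug₂ hπ₂ w₂ t₂ ht₂ =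
      hilbTangentProbe X ι₀ π₁ h₁ aug₁ hπ₁ (w₂ ∘ₗ g) t₁ ht₁ ≫ normalSheafAbScalar ι₀ (subschemeScalar X ι₀ 1) := by
  -- `T_α ≫ T_{q₂} = T_{q₂ ∘ α} = T_{ᾱ_w ∘ q₁} = T_{q₁} ≫ T_{ᾱ_w}`
  have hsq₂ : (ArtAlg.fnlQuotLift π₂ h₂ w₂).comp ((ArtAlg.fnlQuotMk π₂ h₂ w₂).comp α) = ((AlgHom.id k ↥A₂).comp ᾱ).comp π₁ :=
    ArtAlg.comp_sq π₁ π₂ α ᾱ hsq _ _ _ (ArtAlg.kerQuot_sq π₂ h₂ _ _)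
  have hsq₁ : (ArtAlg.fnlQuotLift π₂ h₂ w₂).comp ((ArtAlg.fnlQuotMap π₁ h₁ π₂ h₂ α g hg w₂).comp (ArtAlg.fnlQuotMk π₁ h₁ (w₂ ∘ₗ g))) =
      (ᾱ.comp (AlgHom.id k ↥A₁)).comp π₁ :=
    ArtAlg.comp_sq π₁ _ (ArtAlg.fnlQuotMk π₁ h₁ (w₂ ∘ₗ g)) (AlgHom.id k ↥A₁) (ArtAlg.kerQuot_sq π₁ h₁ _ _) _ _ ᾱ
      (ArtAlg.kerQuotLift_comp_kerQuotMap π₁ h₁ _ _ π₂ h₂ _ _ α ᾱ hsq _)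
  rw [← Category.assoc, hilbTangentSheafMap_comp X ι₀ π₁ h₁ aug₁ π₂ h₂ aug₂ _ _ _ α ᾱ hsq hπ₂ _ _ _ _ hsq₂,
    hilbTangentSheafMap_congr X ι₀ π₁ h₁ aug₁ _ _ _ hsq₂ hsq₁ _ (ArtAlg.kerQuotMap_comp_mk π₁ h₁ _ _ π₂ h₂ _ _ α _).symm
      (by rw [AlgHom.id_comp, AlgHom.comp_id]),
    ← hilbTangentSheafMap_comp X ι₀ π₁ h₁ aug₁ _ _ (ArtAlg.fnlQuot π₁ h₁ (w₂ ∘ₗ g)).residue _ _ _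
      (ArtAlg.fnlQuotMk π₁ h₁ (w₂ ∘ₗ g)) (AlgHom.id k ↥A₁) (ArtAlg.kerQuot_sq π₁ h₁ _ _)
      (ArtAlg.kerQuotLift_surjective π₁ h₁ _ _ hπ₁) (ArtAlg.fnlQuotMap π₁ h₁ π₂ h₂ α g hg w₂) ᾱ
      (ArtAlg.kerQuotLift_comp_kerQuotMap π₁ h₁ _ _ π₂ h₂ _ _ α ᾱ hsq _) (ArtAlg.kerQuotLift_surjective π₂ h₂ _ _ hπ₂) hsq₁,
    Category.assoc, Category.assoc]
  congr 1
  -- base change between the principal quotients along `ᾱ_w t̄₁ = w₂(g t₁) · t̄₂ = 1 · t̄₂`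
  have hc := ArtAlg.fnlQuotMap_coe_fnlGen π₁ h₁ π₂ h₂ α g hg w₂ t₁ t₂ ht₂
  rw [show w₂ (g t₁) = 1 from ht₁] at hc
  exact hilbTangentSheafMap_comp_hilbTangentNormalIso_hom X ι₀ _ _ _ (ArtAlg.fnlGen π₁ h₁ (w₂ ∘ₗ g) t₁)
    (ArtAlg.fnlGen_ne_zero π₁ h₁ _ t₁ ht₁) (ArtAlg.exists_eq_smul_fnlGen π₁ h₁ _ t₁ ht₁) _ _ _ (ArtAlg.fnlGen π₂ h₂ w₂ t₂)
    (ArtAlg.fnlGen_ne_zero π₂ h₂ w₂ t₂ ht₂) (ArtAlg.exists_eq_smul_fnlGen π₂ h₂ w₂ t₂ ht₂) _ ᾱ _ _ 1 hc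

/-- … and `T_α ≫ ρ_{w₂} = 0` when `w₂` vanishes on `α(J₁)`. [cite: Manetti1999DeformationTheoryDGLA, Def. 2.12 (2)]
[cite: Hartshorne2010, §11 Definition (b), p. 96] -/
theorem hilbTangentSheafMap_comp_hilbTangentProbe_eq_zero {A'₁ A₁ A'₂ A₂ : ArtAlg.{u} k}
    (π₁ : A'₁ →ₐ[k] A₁) (h₁ : RingHom.ker π₁ * maximalIdeal A'₁ = ⊥) (aug₁ : ↥A'₁ →ₐ[k] k)
    (π₂ : A'₂ →ₐ[k] A₂) (h₂ : RingHom.ker π₂ * maximalIdeal A'₂ = ⊥) (aug₂ : ↥A'₂ →ₐ[k] k) (hπ₂ : Function.Surjective π₂)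
    (α : ↥A'₁ →ₐ[k] ↥A'₂) (ᾱ : ↥A₁ →ₐ[k] ↥A₂) (hsq : π₂.comp α = ᾱ.comp π₁)
    (g : ↥(ArtAlg.kerSubmodule π₁) →ₗ[k] ↥(ArtAlg.kerSubmodule π₂)) (hg : ∀ j, ((g j : ↥(ArtAlg.kerSubmodule π₂)) : ↥A'₂) = α j)
    (w₂ : ↥(ArtAlg.kerSubmodule π₂) →ₗ[k] k) (t₂ : ↥(ArtAlg.kerSubmodule π₂)) (ht₂ : w₂ t₂ = 1) (hw : w₂ ∘ₗ g = 0) :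
    hilbTangentSheafMap X ι₀ π₁ h₁ aug₁ π₂ h₂ aug₂ α ᾱ hsq hπ₂ ≫ hilbTangentProbe X ι₀ π₂ h₂ aug₂ hπ₂ w₂ t₂ ht₂ = 0 := by
  have hsq₂ : (ArtAlg.fnlQuotLift π₂ h₂ w₂).comp ((ArtAlg.fnlQuotMk π₂ h₂ w₂).comp α) = ((AlgHom.id k ↥A₂).comp ᾱ).comp π₁ :=
    ArtAlg.comp_sq π₁ π₂ α ᾱ hsq _ _ _ (ArtAlg.kerQuot_sq π₂ h₂ _ _)
  have hα0 : ∀ j : ↥(ArtAlg.kerSubmodule π₁), α (j : ↥A'₁) ∈ ArtAlg.fnlKer π₂ w₂ := fun j => by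
    rw [← hg]
    exact (ArtAlg.coe_mem_fnlKer_iff π₂ w₂ (g j)).2 (by rw [← LinearMap.comp_apply, hw, LinearMap.zero_apply])
  rw [← Category.assoc, hilbTangentSheafMap_comp X ι₀ π₁ h₁ aug₁ π₂ h₂ aug₂ _ _ _ α ᾱ hsq hπ₂ _ _ _ _ hsq₂,
    hilbTangentSheafMap_eq_zero_of_map_ker X ι₀ π₁ h₁ aug₁ _ _ _ _ _ hsq₂ _
      (ArtAlg.kerQuotMk_comp_apply_eq_zero π₁ π₂ h₂ _ _ α hα0),
    zero_comp]

variable (hloc : ∀ ⦃A' A : ArtAlg.{u} k⦄ (p : A' →ₐ[k] A), IsSmallExt k p → ∀ (y : (localHilbertFunctor X ι₀.ker).obj A) (z : Z),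
  ∃ V : Z.Opens, z ∈ V ∧ Nonempty (liftsOver X ι₀ p y V))

set_option maxHeartbeats 400000 in
/-- **Base change of `Φ(ob)` along a morphism of small extensions**: `ob(ᾱ_* y, p₂) = (𝟙 ⊗ α|_J)(ob(y, p₁))` in
`H¹(Z, 𝒩_{Z/X}) ⊗_k J₂` — checked probe by probe (`w₂` of `J₂` ↦ `w₂ ∘ α|_J` of `J₁`), using the functoriality of the
tangent-sheaf class (`liftObstruction_map`) and the two cases above. [cite: Manetti1999DeformationTheoryDGLA, Def. 2.12 (2)]
[cite: FantechiManetti1999T1Lifting, Def. 0.1 (ii)] [cite: Hartshorne2010, §11 Definition (b) and Ex. 15.5 (2)] -/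
theorem localHilbertFunctor.normalObstructionKer_functorial {A'₁ A₁ A'₂ A₂ : ArtAlg.{u} k} (p₁ : A'₁ →ₐ[k] A₁)
    (hp₁ : IsSmallExt k p₁) (p₂ : A'₂ →ₐ[k] A₂) (hp₂ : IsSmallExt k p₂) (α : ↥A'₁ →ₐ[k] ↥A'₂) (ᾱ : ↥A₁ →ₐ[k] ↥A₂)
    (hcomm : p₂.comp α = ᾱ.comp p₁) (y : (localHilbertFunctor X ι₀.ker).obj A₁) :
    letI := normalCohomologyModuleK X ι₀ 1
    localHilbertFunctor.normalObstructionKer X ι₀ p₂ hp₂ ((localHilbertFunctor X ι₀.ker).map ᾱ y)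
        (hloc p₂ hp₂ ((localHilbertFunctor X ι₀.ker).map ᾱ y)) =
      (kerMap α hcomm).lTensor (HodgeTheory.normalSheafCohomology ι₀ 1)
        (localHilbertFunctor.normalObstructionKer X ι₀ p₁ hp₁ y (hloc p₁ hp₁ y)) := by
  letI := normalCohomologyModuleK X ι₀ 1
  classical
  have hπ₁ := hp₁.surjective
  have hπ₂ := hp₂.surjective
  -- the kernel map on Schlessinger's `kerSubmodule`s
  let g : ↥(ArtAlg.kerSubmodule p₁) →ₗ[k] ↥(ArtAlg.kerSubmodule p₂) :=
    ((ArtAlg.kerSubmoduleEquivKer p₂).symm : ↥(kerₖ k p₂) →ₗ[k] ↥(ArtAlg.kerSubmodule p₂)) ∘ₗ kerMap α hcomm ∘ₗ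
      (ArtAlg.kerSubmoduleEquivKer p₁ : ↥(ArtAlg.kerSubmodule p₁) →ₗ[k] ↥(kerₖ k p₁))
  have hg : ∀ j, ((g j : ↥(ArtAlg.kerSubmodule p₂)) : ↥A'₂) = α j := fun j => rfl
  let b₂ := (ArtAlg.kerBasis p₂).map (ArtAlg.kerSubmoduleEquivKer p₂)
  -- functoriality of the tangent-sheaf class
  rw [localHilbertFunctor.normalObstructionKer_def, localHilbertFunctor.normalObstructionKer_def,
    ← localHilbertFunctor.liftObstruction_map X ι₀ p₁ hp₁.ker_mul_maximalIdeal A'₁.residue hπ₁ p₂ hp₂.ker_mul_maximalIdeal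
      A'₂.residue hπ₂ α ᾱ hcomm y (hloc p₁ hp₁ y) (hloc p₂ hp₂ _)]
  generalize localHilbertFunctor.liftObstruction X ι₀ p₁ hp₁.ker_mul_maximalIdeal A'₁.residue hπ₁ y (hloc p₁ hp₁ y) = x₁
  refine tmul_ext_of_lTensor_coord b₂ _ _ fun l => ?_
  -- the probe `b₂.coord l`, read on `kerSubmodule p₂`, and its pull-back `∘ g` to `kerSubmodule p₁`
  have ht₂ : (b₂.coord l ∘ₗ (ArtAlg.kerSubmoduleEquivKer p₂ : ↥(ArtAlg.kerSubmodule p₂) →ₗ[k] ↥(kerₖ k p₂)))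
      (ArtAlg.kerBasis p₂ l) = 1 := by
    change b₂.coord l (ArtAlg.kerSubmoduleEquivKer p₂ (ArtAlg.kerBasis p₂ l)) = 1
    rw [show ArtAlg.kerSubmoduleEquivKer p₂ (ArtAlg.kerBasis p₂ l) = b₂ l from (Module.Basis.map_apply _ _ _).symm,
      Module.Basis.coord_apply, Module.Basis.repr_self, Finsupp.single_eq_same]
  have hwg : (b₂.coord l ∘ₗ (ArtAlg.kerSubmoduleEquivKer p₂ : ↥(ArtAlg.kerSubmodule p₂) →ₗ[k] ↥(kerₖ k p₂))) ∘ₗ g =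
      (b₂.coord l ∘ₗ kerMap α hcomm) ∘ₗ (ArtAlg.kerSubmoduleEquivKer p₁ : ↥(ArtAlg.kerSubmodule p₁) →ₗ[k] ↥(kerₖ k p₁)) :=
    rfl
  rw [← LinearMap.lTensor_comp_apply, ← LinearMap.lTensor_comp_apply, ← LinearMap.lTensor_comp_apply, ← hwg,
    hilbTangentH1Coord_lTensor X ι₀ p₂ _ _ hπ₂ _ _ ht₂, ← Sheaf.H.map_comp_apply]
  by_cases hw : (b₂.coord l ∘ₗ (ArtAlg.kerSubmoduleEquivKer p₂ : ↥(ArtAlg.kerSubmodule p₂) →ₗ[k] ↥(kerₖ k p₂))) ∘ₗ g = 0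
  · rw [hilbTangentSheafMap_comp_hilbTangentProbe_eq_zero X ι₀ p₁ _ _ p₂ _ _ hπ₂ α ᾱ hcomm g hg _ _ ht₂ hw, hw,
      LinearMap.lTensor_zero, LinearMap.zero_apply]
    have h0 := Sheaf.H.map_add_apply (0 : hilbTangentSheaf X ι₀ p₁ hp₁.ker_mul_maximalIdeal A'₁.residue ⟶ normalSheafAb ι₀) 0 x₁
    rw [add_zero] at h0
    rw [left_eq_add.mp h0, TensorProduct.zero_tmul]
  · obtain ⟨t₁, ht₁⟩ := exists_apply_eq_one _ hw
    have hE : Sheaf.H.map (hilbTangentProbe X ι₀ p₁ hp₁.ker_mul_maximalIdeal A'₁.residue hπ₁ _ t₁ ht₁ ≫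
          normalSheafAbScalar ι₀ (subschemeScalar X ι₀ 1)) 1 x₁ =
        Sheaf.H.map (hilbTangentProbe X ι₀ p₁ hp₁.ker_mul_maximalIdeal A'₁.residue hπ₁ _ t₁ ht₁) 1 x₁ :=
      (Sheaf.H.map_comp_apply (hilbTangentProbe X ι₀ p₁ hp₁.ker_mul_maximalIdeal A'₁.residue hπ₁ _ t₁ ht₁)
          (normalSheafAbScalar ι₀ (subschemeScalar X ι₀ 1)) x₁).trans
        ((normalCohomology_smul_eq_map X ι₀ 1 _).symm.trans (one_smul k _))
    rw [hilbTangentSheafMap_comp_hilbTangentProbe X ι₀ p₁ _ _ hπ₁ p₂ _ _ hπ₂ α ᾱ hcomm g hg _ _ ht₂ t₁ ht₁,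
      hilbTangentH1Coord_lTensor X ι₀ p₁ _ _ hπ₁ _ t₁ ht₁]
    exact congrArg (fun v => v ⊗ₜ[k] (1 : k)) hE

/-- **THE OBSTRUCTION THEORY OF THE LOCAL HILBERT FUNCTOR WITH VALUES IN `H¹(Z, 𝒩_{Z/X})`** — [Hartshorne2010, Thm. 6.2 (b)]
(`α ∈ H¹(Y₀, 𝒩₀ ⊗_k J)`), for every small extension `0 → J → A′ → A → 0` of `Art_k` (any `dim_k J`) and compatibly with
morphisms of small extensions, packaged as [Manetti1999DeformationTheoryDGLA, Def. 2.12]'s `ArtinFunctor.ObstructionTheory`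
(`CompatibleObstructionTheories.lean`) for `H_Z^X = localHilbertFunctor X ι₀.ker`, under Thm. 6.2 (b)'s hypothesis that lifts exist
locally on `Z` (`hloc`). Definition with body. [cite: Hartshorne2010, Thm. 6.2 (b), pp. 47–49, and §11 Definition, p. 96]
[cite: Manetti1999DeformationTheoryDGLA, Def. 2.12] [cite: FantechiManetti1999T1Lifting, Def. 0.1] -/
def localHilbertFunctor.normalObstructionTheory :
    letI := normalCohomologyModuleK X ι₀ 1
    (localHilbertFunctor X ι₀.ker).ObstructionTheory (HodgeTheory.normalSheafCohomology ι₀ 1) :=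
  letI := normalCohomologyModuleK X ι₀ 1
  { ob := fun p hp y => localHilbertFunctor.normalObstructionKer X ι₀ p hp y (hloc p hp y)
    ob_eq_zero_of_exists := fun p hp y ⟨y', hy'⟩ =>
      localHilbertFunctor.normalObstructionKer_eq_zero_of_map_eq X ι₀ p hp y (hloc p hp y) y' hy'
    functorial := fun p₁ hp₁ p₂ hp₂ α ᾱ hcomm y =>
      localHilbertFunctor.normalObstructionKer_functorial X ι₀ hloc p₁ hp₁ p₂ hp₂ α ᾱ hcomm y }

/-- The obstruction maps of `normalObstructionTheory` are the classes `normalObstructionKer` (by `rfl`).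
[cite: Hartshorne2010, Thm. 6.2 (b), p. 47] -/
theorem localHilbertFunctor.normalObstructionTheory_ob {A' A : ArtAlg.{u} k} (p : A' →ₐ[k] A) (hp : IsSmallExt k p)
    (y : (localHilbertFunctor X ι₀.ker).obj A) :
    letI := normalCohomologyModuleK X ι₀ 1
    (localHilbertFunctor.normalObstructionTheory X ι₀ hloc).ob p hp y =
      localHilbertFunctor.normalObstructionKer X ι₀ p hp y (hloc p hp y) :=
  rfl

/-- **The obstruction theory is COMPLETE** (`Z ≠ ∅`): `ob(y, p) = 0` iff `y` lifts — Thm. 6.2 (b) «necessary and sufficient».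
[cite: Hartshorne2010, Thm. 6.2 (b), pp. 47–49] [cite: Manetti1999DeformationTheoryDGLA, Def. 2.13] -/
theorem localHilbertFunctor.normalObstructionTheory_isComplete [Nonempty Z] :
    letI := normalCohomologyModuleK X ι₀ 1
    (localHilbertFunctor.normalObstructionTheory X ι₀ hloc).IsComplete := by
  letI := normalCohomologyModuleK X ι₀ 1
  intro A' A p hp y h
  exact (localHilbertFunctor.normalObstructionKer_eq_zero_iff X ι₀ p hp y (hloc p hp y)).1 h

/-- **… hence an obstruction space in the sense of [FantechiManetti1999T1Lifting, Def. 0.1]** (`Z ≠ ∅`), via the tree's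
`ObstructionTheory.toObstructionSpace`. Definition with body. [cite: FantechiManetti1999T1Lifting, Def. 0.1]
[cite: Hartshorne2010, Thm. 6.2 (b), pp. 47–49] -/
def localHilbertFunctor.normalObstructionSpace [Nonempty Z] :
    letI := normalCohomologyModuleK X ι₀ 1
    (localHilbertFunctor X ι₀.ker).ObstructionSpace (HodgeTheory.normalSheafCohomology ι₀ 1) :=
  letI := normalCohomologyModuleK X ι₀ 1
  (localHilbertFunctor.normalObstructionTheory X ι₀ hloc).toObstructionSpace
    (localHilbertFunctor.normalObstructionTheory_isComplete X ι₀ hloc)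

end Theory

end Literature.AlgebraicGeometry.Deformation
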